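import Summits.Parity.BatemanHorn.Theorems.SoloInformedWindowEquidistribution
import Summits.Parity.BatemanHorn.Theorems.SoloInformedErdosNairParams
import Summits.Parity.BatemanHorn.Theorems.SoloInformedDivisorStoreyGeneral
import Summits.Parity.BatemanHorn.Theorems.SoloInformedRootLevelConstPos
import HarnessLib

/-!
# The located root count outgrows `x`: `Mid_g(x)/x → ∞` for irreducible `g` of degree `≥ 3`

For an irreducible `g ∈ ℤ[X]` of degree `d`, the LOCATED ROOT COUNT
`Mid_g(x) = #{(n, e) : 1 ≤ n ≤ x, e ∣ g(n), x < e, e² < |g(n)|}` (`polyLocatedRootCount`) is the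
open half of Erdős's divisor problem `S_g(x) = ∑_{n ≤ x} τ(|g(n)|)`: unconditionally
`S_g(x) = 2·A_g·x log x + 2·Mid_g(x) + O_g(x)`
(`exists_abs_polyDivisorSum_sub_located_sub_log_le_of_two_le`), and conjecturally
`Mid_g(x) ∼ ((d−2)/2)·A_g·x log x`.  For `d = 2` one has `Mid_g(x) = O(x)`.

This file proves the first unconditional GROWTH statement for `d ≥ 3`:

* `tendsto_polyLocatedRootCount_div_atTop`: `Mid_g(x)/x → ∞`;
* `tendsto_polyDivisorSum_sub_div_atTop`: `(S_g(x) − 2·A_g·x log x)/x → +∞` — the constant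
  `2A_g` of the kernel-checked Erdős lower bound `S_g(x) ≥ 2A_g x log x − Cx`
  (`exists_polyDivisorSum_lower`) is never the truth for `d ≥ 3`.

## Proof

By the bounded-window equidistribution theorem (`exists_abs_polyWindowRootCount_sub_log_le`,
Hooley 1964 at fixed scales + Erdős–Turán): `W_g(x; x, Tx) ≥ A_g·x·log T − K·x` for
`x ≥ x₀(T)`, with `K` independent of `T`.  A pair `(n, e)` counted by the window count
`W_g(x; x, Tx)` but not by `Mid_g(x)` has `|g(n)| ≤ e² ≤ (Tx)²`
(`polyWindowRootCount_le_located_add`); since `|g(n)| ≍ n^d` with `d ≥ 3`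
(`exists_abs_log_natAbs_eval_sub_le`) such `n` are `≤ e^{B/3}(Tx)^{2/3}`
(`card_filter_natAbs_eval_le_exp`), and each carries `τ(|g(n)|) ≤ C_F·x^{1/96}` divisors
(`ErdosDivisor.exists_card_divisors_eval_le`); so the non-located part of the window is `≤ x`
for `x ≥ x₁(T)` (`exists_sum_card_divisors_small_le`).  Hence
`Mid_g(x) ≥ (A_g log T − K − 1)·x` eventually, for every `T`.  [this work]
-/

open Finset Polynomial Filter
open scoped Topology

namespace Summit.Parity.BatemanHorn.Theorems

/-! ### The window count versus the located count -/

/-- Per value: the divisors of `N` in the window `(x, y]` are located (`e² < N`) except, when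
`N ≤ y²`, at most `τ(N)` of them. [this work] -/
theorem card_divisors_window_le_located_add (N x y : ℕ) :
    #(N.divisors.filter fun e => x < e ∧ e ≤ y)
      ≤ #(N.divisors.filter fun e => x < e ∧ e * e < N)
        + (if N ≤ y * y then #N.divisors else 0) := by
  set s := N.divisors.filter fun e => x < e ∧ e ≤ y with hs
  have hsplit := card_filter_add_card_filter_not (s := s) (fun e => e * e < N)
  have h1 : #(s.filter fun e => e * e < N)
      ≤ #(N.divisors.filter fun e => x < e ∧ e * e < N) := by
    refine card_le_card fun e he => ?_
    simp only [hs, mem_filter] at he ⊢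
    exact ⟨he.1.1, he.1.2.1, he.2⟩
  have h2 : #(s.filter fun e => ¬ (e * e < N)) ≤ (if N ≤ y * y then #N.divisors else 0) := by
    split_ifs with hN
    · refine card_le_card fun e he => ?_
      simp only [hs, mem_filter] at he
      exact he.1.1
    · rw [card_eq_zero.2 (filter_eq_empty_iff.2 fun e he => by
        simp only [hs, mem_filter] at he
        exact not_not.2 (lt_of_le_of_lt (Nat.mul_le_mul he.2.2 he.2.2) (not_le.1 hN)))]
  calc #s = #(s.filter fun e => e * e < N) + #(s.filter fun e => ¬ (e * e < N)) := hsplit.symm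
    _ ≤ _ := Nat.add_le_add h1 h2

/-- **Window count ≤ located count + divisors of the small values**:
`W_g(x; x, y) ≤ Mid_g(x) + ∑_{n ≤ x, |g(n)| ≤ y²} τ(|g(n)|)`. [this work] -/
theorem polyWindowRootCount_le_located_add (g : ℤ[X]) (x y : ℕ) :
    polyWindowRootCount g x x y
      ≤ polyLocatedRootCount g x
        + ∑ n ∈ (Icc 1 x).filter (fun n : ℕ => (g.eval (n : ℤ)).natAbs ≤ y * y),
            #((g.eval (n : ℤ)).natAbs.divisors) := by
  unfold polyWindowRootCount polyLocatedRootCount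
  rw [sum_filter, ← sum_add_distrib]
  exact sum_le_sum fun n _ => card_divisors_window_le_located_add _ x y

/-! ### The values `|g(n)| ≤ Y` are few when `deg g ≥ 3` -/

/-- For `deg g ≥ 3` with `|log |g(n)| − d log n| ≤ B` and `g(n) ≠ 0` (`n ≥ 1`): the `n ∈ [1, x]`
with `|g(n)| ≤ Y` number at most `exp((log Y + B)/3)` (`= e^{B/3}·Y^{1/3}` for `Y ≥ 1`).
[this work] -/
theorem card_filter_natAbs_eval_le_exp {g : ℤ[X]} (hdeg : 3 ≤ g.natDegree) {B : ℝ}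
    (hB : ∀ n : ℕ, 1 ≤ n →
      |Real.log ((g.eval (n : ℤ)).natAbs : ℝ) - g.natDegree * Real.log n| ≤ B)
    (hz : ∀ n : ℕ, 1 ≤ n → g.eval (n : ℤ) ≠ 0) (x Y : ℕ) :
    (#((Icc 1 x).filter fun n : ℕ => (g.eval (n : ℤ)).natAbs ≤ Y) : ℝ)
      ≤ Real.exp ((Real.log Y + B) / 3) := by
  set R : ℝ := Real.exp ((Real.log Y + B) / 3) with hR
  have hsub : (Icc 1 x).filter (fun n : ℕ => (g.eval (n : ℤ)).natAbs ≤ Y) ⊆ Icc 1 ⌊R⌋₊ := by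
    intro n hn
    rw [mem_filter, mem_Icc] at hn
    obtain ⟨⟨hn1, -⟩, hnY⟩ := hn
    rw [mem_Icc]
    refine ⟨hn1, Nat.le_floor ?_⟩
    have hn0 : (0 : ℝ) < n := by exact_mod_cast hn1
    have hg1 : (1 : ℝ) ≤ ((g.eval (n : ℤ)).natAbs : ℝ) := by
      exact_mod_cast Nat.one_le_iff_ne_zero.2 (Int.natAbs_ne_zero.2 (hz n hn1))
    have hlogg : Real.log ((g.eval (n : ℤ)).natAbs : ℝ) ≤ Real.log Y :=
      Real.log_le_log (by linarith) (by exact_mod_cast hnY)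
    have hd : (3 : ℝ) ≤ g.natDegree := by exact_mod_cast hdeg
    have hlogn : 0 ≤ Real.log n := Real.log_nonneg (by exact_mod_cast hn1)
    have h := (abs_le.1 (hB n hn1)).1
    have h3 : 3 * Real.log n ≤ g.natDegree * Real.log n := mul_le_mul_of_nonneg_right hd hlogn
    have hle : Real.log n ≤ (Real.log Y + B) / 3 := by linarith
    calc (n : ℝ) = Real.exp (Real.log n) := (Real.exp_log hn0).symm
      _ ≤ R := Real.exp_le_exp.2 hle
  calc (#((Icc 1 x).filter fun n : ℕ => (g.eval (n : ℤ)).natAbs ≤ Y) : ℝ)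
      ≤ (#(Icc 1 ⌊R⌋₊) : ℝ) := by exact_mod_cast card_le_card hsub
    _ = ⌊R⌋₊ := by rw [Nat.card_Icc, Nat.add_sub_cancel]
    _ ≤ R := Nat.floor_le (Real.exp_pos _).le

/-- **The non-located part of a bounded window is eventually `≤ x`** (`deg g ≥ 3`, `T ≥ 1`):
`∑_{n ≤ x, |g(n)| ≤ (Tx)²} τ(|g(n)|) ≤ x` for `x ≥ x₁(g, T)`. [this work] -/
theorem exists_sum_card_divisors_small_le {g : ℤ[X]} (hirr : Irreducible g)
    (hdeg : 3 ≤ g.natDegree) {T : ℕ} (hT : 1 ≤ T) :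
    ∃ x₁ : ℕ, ∀ x : ℕ, x₁ ≤ x →
      (∑ n ∈ (Icc 1 x).filter (fun n : ℕ => (g.eval (n : ℤ)).natAbs ≤ T * x * (T * x)),
          (#((g.eval (n : ℤ)).natAbs.divisors) : ℝ)) ≤ x := by
  obtain ⟨B, hB⟩ := exists_abs_log_natAbs_eval_sub_le (g := g) (by omega)
  obtain ⟨CF, hCF0, hCF⟩ := ErdosDivisor.exists_card_divisors_eval_le (g := g) (by omega)
  have hz : ∀ n : ℕ, 1 ≤ n → g.eval (n : ℤ) ≠ 0 :=
    fun n _ => eval_natCast_ne_zero_of_irreducible hirr (by omega) n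
  set CF' : ℝ := max CF 1 with hCF'
  have hCF'pos : 0 < CF' := lt_of_lt_of_le one_pos (le_max_right _ _)
  set c : ℝ := (2 * Real.log T + B) / 3 + Real.log CF' with hc
  set Q : ℝ := 96 / 31 * c with hQ
  refine ⟨max 1 ⌈Real.exp Q⌉₊, fun x hx => ?_⟩
  have hx1 : 1 ≤ x := le_of_max_le_left hx
  have hxQ : ⌈Real.exp Q⌉₊ ≤ x := le_of_max_le_right hx
  have hxpos : (0 : ℝ) < x := by exact_mod_cast hx1
  have hTpos : (0 : ℝ) < T := by exact_mod_cast hT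
  have hlogx : Q ≤ Real.log x := by
    have h1 : Real.exp Q ≤ (x : ℝ) := (Nat.le_ceil _).trans (by exact_mod_cast hxQ)
    have := Real.log_le_log (Real.exp_pos Q) h1
    rwa [Real.log_exp] at this
  -- the set of small values
  set F := (Icc 1 x).filter (fun n : ℕ => (g.eval (n : ℤ)).natAbs ≤ T * x * (T * x)) with hF
  have hlogY : Real.log ((T * x * (T * x) : ℕ) : ℝ) = 2 * (Real.log T + Real.log x) := by
    push_cast
    rw [Real.log_mul (by positivity) (by positivity), Real.log_mul hTpos.ne' hxpos.ne']
    ring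
  have hcount : (#F : ℝ) ≤ Real.exp ((2 * (Real.log T + Real.log x) + B) / 3) := by
    have := card_filter_natAbs_eval_le_exp hdeg hB hz x (T * x * (T * x))
    rwa [hlogY] at this
  have hx96 : (x : ℝ) ^ (1 / 96 : ℝ) = Real.exp (Real.log x * (1 / 96)) :=
    Real.rpow_def_of_pos hxpos _
  have hprod : Real.exp ((2 * (Real.log T + Real.log x) + B) / 3) * (CF' * (x : ℝ) ^ (1 / 96 : ℝ))
      = Real.exp ((2 * (Real.log T + Real.log x) + B) / 3 + Real.log CF'
          + Real.log x * (1 / 96)) := by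
    rw [Real.exp_add, Real.exp_add, Real.exp_log hCF'pos, ← hx96]; ring
  have hexp : (2 * (Real.log T + Real.log x) + B) / 3 + Real.log CF' + Real.log x * (1 / 96)
      ≤ Real.log x := by
    rw [hQ, hc] at hlogx
    linarith
  calc (∑ n ∈ F, (#((g.eval (n : ℤ)).natAbs.divisors) : ℝ))
      ≤ ∑ n ∈ F, CF * (x : ℝ) ^ (1 / 96 : ℝ) :=
        sum_le_sum fun n hn => hCF x hx1 n ((filter_subset _ _) hn)
    _ = #F * (CF * (x : ℝ) ^ (1 / 96 : ℝ)) := by rw [sum_const, nsmul_eq_mul]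
    _ ≤ Real.exp ((2 * (Real.log T + Real.log x) + B) / 3) * (CF' * (x : ℝ) ^ (1 / 96 : ℝ)) :=
        mul_le_mul hcount (mul_le_mul_of_nonneg_right (le_max_left _ _) (by positivity))
          (by positivity) (Real.exp_pos _).le
    _ = Real.exp ((2 * (Real.log T + Real.log x) + B) / 3 + Real.log CF'
          + Real.log x * (1 / 96)) := hprod
    _ ≤ Real.exp (Real.log x) := Real.exp_le_exp.2 hexp
    _ = x := Real.exp_log hxpos

/-! ### The divergence theorems -/

/-- **The located root count outgrows `x`** (unconditional): for every irreducible `g ∈ ℤ[X]` of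
degree `≥ 3`, `Mid_g(x)/x → ∞`.  Indeed `Mid_g(x) ≥ (A_g log T − K − 1)·x` for `x ≥ x₂(T)`, every
`T ≥ 1`, by the bounded-window equidistribution theorem.  (For degree `2`, `Mid_g(x) = O(x)`.)
[this work; window input: Hooley, Acta Math. 111 (1964), via
`hooley_polyRoots_equidistributed_holds`] -/
theorem tendsto_polyLocatedRootCount_div_atTop {g : ℤ[X]} (hirr : Irreducible g)
    (hdeg : 3 ≤ g.natDegree) :
    Tendsto (fun x : ℕ => (polyLocatedRootCount g x : ℝ) / x) atTop atTop := by
  obtain ⟨K, hK⟩ := exists_abs_polyWindowRootCount_sub_log_le hirr (by omega : 2 ≤ g.natDegree)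
  have hA := rootLevelConst_pos hirr (by omega : 0 < g.natDegree)
  refine tendsto_atTop.2 fun M => ?_
  -- a window length `T` with `A_g log T ≥ |M| + K + 2`
  set q : ℝ := (|M| + K + 2) / rootLevelConst g with hq
  set T : ℕ := max 1 ⌈Real.exp q⌉₊ with hTdef
  have hT1 : 1 ≤ T := le_max_left _ _
  have hTq : q ≤ Real.log T := by
    have h1 : Real.exp q ≤ (T : ℝ) :=
      (Nat.le_ceil _).trans (by exact_mod_cast le_max_right 1 ⌈Real.exp q⌉₊)
    have := Real.log_le_log (Real.exp_pos q) h1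
    rwa [Real.log_exp] at this
  have hAT : |M| + K + 2 ≤ rootLevelConst g * Real.log T := by
    have h := (div_le_iff₀ hA).1 hTq
    linarith
  obtain ⟨x₀, hx₀⟩ := hK T hT1
  obtain ⟨x₁, hx₁⟩ := exists_sum_card_divisors_small_le hirr hdeg hT1
  refine eventually_atTop.2 ⟨max x₀ (max x₁ 1), fun x hx => ?_⟩
  have hxx₀ : x₀ ≤ x := le_of_max_le_left hx
  have hxx₁ : x₁ ≤ x := le_of_max_le_left (le_of_max_le_right hx)
  have hx1 : 1 ≤ x := le_of_max_le_right (le_of_max_le_right hx)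
  have hxpos : (0 : ℝ) < x := by exact_mod_cast hx1
  rw [le_div_iff₀ hxpos]
  have hW := (abs_le.1 (hx₀ x hxx₀)).1
  have hB := hx₁ x hxx₁
  have hsplit : (polyWindowRootCount g x x (T * x) : ℝ)
      ≤ polyLocatedRootCount g x
        + ∑ n ∈ (Icc 1 x).filter (fun n : ℕ => (g.eval (n : ℤ)).natAbs ≤ T * x * (T * x)),
            (#((g.eval (n : ℤ)).natAbs.divisors) : ℝ) := by
    exact_mod_cast polyWindowRootCount_le_located_add g x (T * x)
  have hM : M ≤ |M| := le_abs_self M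
  have h1 : (|M| + K + 2) * x ≤ rootLevelConst g * Real.log T * x :=
    mul_le_mul_of_nonneg_right hAT hxpos.le
  have h2 : M * (x : ℝ) ≤ |M| * x := mul_le_mul_of_nonneg_right hM hxpos.le
  linarith

/-- **Erdős's lower-bound constant is never attained in degree `≥ 3`** (unconditional): for every
irreducible `g` of degree `≥ 3`, `(S_g(x) − 2·A_g·x log x)/x → +∞`, where
`S_g(x) = ∑_{n ≤ x} τ(|g(n)|)` and `A_g = rootLevelConst g`.  Combine
`S_g = 2A_g x log x + 2Mid_g + O(x)` with `tendsto_polyLocatedRootCount_div_atTop`. [this work] -/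
theorem tendsto_polyDivisorSum_sub_div_atTop {g : ℤ[X]} (hirr : Irreducible g)
    (hdeg : 3 ≤ g.natDegree) :
    Tendsto (fun x : ℕ =>
      ((polyDivisorSum g x : ℝ) - 2 * rootLevelConst g * (x : ℝ) * Real.log x) / x)
      atTop atTop := by
  obtain ⟨C, hC⟩ := exists_abs_polyDivisorSum_sub_located_sub_log_le_of_two_le hirr (by omega)
  have h := tendsto_polyLocatedRootCount_div_atTop hirr hdeg
  refine tendsto_atTop.2 fun M => ?_
  filter_upwards [tendsto_atTop.1 h ((M + C) / 2), eventually_ge_atTop 2] with x hx hx2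
  have hxpos : (0 : ℝ) < x := by exact_mod_cast (show 0 < x by omega)
  rw [le_div_iff₀ hxpos] at hx ⊢
  have h1 := (abs_le.1 (hC x hx2)).1
  linarith

/-- The same in the `∀ c, eventually` form: for every real `c`, eventually
`2·A_g·x log x + c·x ≤ S_g(x)`. [this work] -/
theorem eventually_le_polyDivisorSum_of_three_le {g : ℤ[X]} (hirr : Irreducible g)
    (hdeg : 3 ≤ g.natDegree) (c : ℝ) :
    ∀ᶠ x : ℕ in atTop,
      2 * rootLevelConst g * (x : ℝ) * Real.log x + c * x ≤ (polyDivisorSum g x : ℝ) := by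
  filter_upwards [tendsto_atTop.1 (tendsto_polyDivisorSum_sub_div_atTop hirr hdeg) c,
    eventually_ge_atTop 1] with x hx hx1
  have hxpos : (0 : ℝ) < x := by exact_mod_cast (show 0 < x by omega)
  rw [le_div_iff₀ hxpos] at hx
  linarith

end Summit.Parity.BatemanHorn.Theorems
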